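import Mathlib.MeasureTheory.Integral.IntervalIntegral.Basic
import Mathlib.Analysis.SpecialFunctions.Integrals.Basic
import Mathlib.MeasureTheory.Function.SpecialFunctions.Basic
import Literature.MathematicalPhysics.KineticTheory.LinearisedPhononCollisionOperator
import Literature.MathematicalPhysics.KineticTheory.KineticSlabConductance
import HarnessLib

/-!
# The Palm-mismatch collision operator of the hard-tether pinned harmonic chain

Topic `Literature/MathematicalPhysics/KineticTheory`; definition request `defn-palmMismatchOperator`
(route CollisionNoise of `AtomisticToContinuum/FouriersLaw`; the collision operator `𝒦` of crux
PalmBoltzmannLimit `stmt-AtomisticToContinuum-7296`, whose odd-sector negativity is the content of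
KineticUpperBound `stmt-AtomisticToContinuum-6563`). This file is the `k`-space (phonon / Wigner)
form of `𝒦`. The finite-ring objects from which it is DERIVED — Palm/Slepian data at a tether hit,
exchange matrices, the nonlinear Palm collision field and its linearisation `palmMismatchLin` — are in
`PalmMismatchRing.lean` (namespace `…KineticTheory.PalmMismatch`), the theorems about them
(`Δ_x(G_T) = 0`; the Palm tilt has zero flow-invariant matrix elements; `𝒦 = 2 ×` exchange) in
`PalmMismatchRingTheorems.lean`.

## Setting and result (author's check of the planner's outline; details in the ring files)

Pinned harmonic chain (`Φ = ω₂ - Δ`, band `ω(k)² = ω₂ + 2(1 - cos k)` = `dispersion`, `k ∈ (-π,π]`,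
Gibbs `G_T = T diag(Φ⁻¹,1)`), hard tether `|q_{x+1} - q_x| ≤ 1` acting at a hit by the exchange
`p_x ↔ p_{x+1}`; under `G_T`: `Var r_x = G(ω₂)T`, `G = 1 - √(ω₂/(ω₂+4))` (`stretchVarianceFactor`),
`Var ṙ_x = 2T`, two-sided Rice rate `ε(T) = π⁻¹√(2/G)e^{-1/(2GT)}` (`riceRateChain`). The request's
`𝒦` = Σ_x Rice weight × E_Palm[(state after `R_x`)^{⊗2} - (state after the free turnaround)^{⊗2}], to
first order in a flow-invariant perturbation `δC` of `G_T`, flow-averaged, per unit `ε`. Carried out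
EXACTLY at fixed `T` with the Gaussian Palm/Slepian data [Aldous1989, §C12 Lemma C12.1, §C22 (C22a),
(C22c), §C25 (C25c)] and the Palm transport of the turnaround [HevelingLast2005, Thm 1.1]:
(i) the zeroth order vanishes identically (`PalmMismatch.palmMismatchIncrement_gibbsCov`: under
`G_T` the exchange maps the up-crossing Palm law onto the down-crossing one), so the perturbed Rice
weight drops out; (ii) `DΔ_x(G_T)[δC] = 2(R_xδCR_xᵀ - δC) + √(πT)(u_x m'ᵀ + m' u_xᵀ)` — twice the
Poisson-exchange increment (factor `2 = E V²/Var ṙ`, `V` the Rayleigh hit speed) plus a Palm tilt of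
size `T^{-1/2}`; (iii) on the ring every flow-invariant matrix element of the tilt vanishes
(`PalmMismatch.trace_mul_palmMismatchLin`), so **`𝒦 = 2 ×` the flow-averaged generator of the
nearest-neighbour exchange noise `S f = γΣ_x(f(p^{x,x+1}) - f(p))` of
[BasileBernardinJaraKomorowskiOlla2016, §1], per unit rate, independently of `T`** (the request
expected a difference; at first order there is none beyond the factor `2`); (iv) on translation- and
flow-invariant data (symbols `ĉ_pp = ω²ĉ_qq = e(k)` even, `ĉ_qp = ih(k)`, `h` odd; ENERGY-density
Wigner function `W = e + ωh`: even part = mode energies, odd part = `ω ×` mode angular momenta, Gibbs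
`W ≡ T`) the flow-averaged exchange generator is the linear Boltzmann operator with the PRODUCT kernel
stated for this noise in [BasileBernardinJaraKomorowskiOlla2016, §6 ("`R(k,k') = R(k)R(k')`,
`∫R = 1`", loss `2γR(k)`)], recomputed here from the covariance dynamics as
`(2-2cos k)(2-2cos k')/(4π)` per unit rate on `(-π,π]`; doubling gives the kernel `ρ` below.
Item (iv) (circulant diagonalisation, `n → ∞`) is documented and checked numerically on rings
`n = 3,…,6` (unit notes), not formalised.

## Contents

* `stretchVarianceFactor`, `riceRateChain` (literally the expression of item 6563).
* `palmMismatchKernel k k' = ρ(k,k') = (2-2cos k)(2-2cos k')/(2π)`, `palmMismatchRate k = 2(2-2cos k)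
  = ∫ρ(k,·)` (`integral_palmMismatchKernel`), and THE REQUESTED NOTION
  `palmMismatchOperator W k = ∫_{(-π,π]} ρ(k,k')(W k' - W k) dk'` on energy-density Wigner profiles
  `W : ℝ → ℝ` (`2π`-periodic `k`), per unit two-sided Rice rate; the kinetic equation of
  PalmBoltzmannLimit reads `∂_τW + ω'(k)∂_yW = 𝒦W` (`y = εx`, `τ = εt`, `ω' = groupVelocity`; this is
  BBJKO's `(2π)⁻¹ω'(κ)∂_y` in the unit-torus variable `κ = k/2π`).
* "Multiplication plus rank-one-per-fibre kernel": `palmMismatchGain`,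
  `palmMismatchOperator_eq_gain_sub_rate_mul`; the odd sector `palmMismatchOperator_odd`:
  `𝒦W = -2(2-2cos k)W = -8sin²(k/2)W` — dissipative, rate vanishing quadratically at `k = 0`, so NO
  uniform gap on the odd sector (`palmMismatchRate_eq_zero_iff`) although `∫ω'²/rate dk < ∞`;
  constants (energy, the Gibbs profile) are annihilated; periodicity; reflection.
* `palmMismatchForm` — the Dirichlet form `½∫∫ρ(W k - W k')(W' k - W' k')`, `≥ 0`, symmetric; formally
  `-⟨W', 𝒦W⟩_{L²(dk)}`; the `G_T` (entropy-Hessian) inner product of energy profiles at `W ≡ T` is `T⁻²×`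
  the flat one, so `⟨W, 𝒦W⟩_{G_T} = -T⁻²𝓔(W,W)`.
* `palmMismatchOperatorW ω₂` (number normalisation `w = W/ω`, equilibrium `T/ω`) and
  `palmMismatchMedium ω₂ : KineticMedium ℝ` (`μ = (2π)⁻¹dk` on `(-π,π]`, `v = ω'`, `refl = (-·)`,
  `e = w = 1`, `dom` = profiles integrable on `(-π,π]`) for `KineticSlabConductance`.

## What is NOT here

* No kinetic LIMIT is asserted (that is crux PalmBoltzmannLimit); the Gaussian/Slepian modelling of
  pre-collision laws and the first-order expansion are the request's prescription.
* The Palm tilt is invisible to flow-invariant forms on the ring but is NOT zero before the flow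
  average (a single bond's tilt is not even flow-null): data finer than flow-averaged second moments
  see a `T^{-1/2}` term.
* No `L²` operator theory (`|ρ| ≤ 8/π`, `palmMismatchKernel_le`, gives boundedness, not packaged);
  `𝒦` is a map on `ℝ → ℝ`, Bochner integral `0` when divergent, like
  `linearisedPhononCollisionOperator`.
-/

noncomputable section

open MeasureTheory Set Real

namespace Literature.MathematicalPhysics.KineticTheory.PhononBoltzmann

/-! ### Gibbs constants of the pinned chain at the tether level `b = 1` -/

/-- The stretch-variance factor of the infinite pinned harmonic chain in its Gibbs state:
`Var(q_{x+1} - q_x) = G(ω₂)·T` with `G(ω₂) = ∫ (2-2cos k)/(ω₂+2-2cos k) dk/2π = 1 - √(ω₂/(ω₂+4))`.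
[folklore] -/
def stretchVarianceFactor (ω₂ : ℝ) : ℝ :=
  1 - Real.sqrt (ω₂ / (ω₂ + 4))

/-- The two-sided Rice rate of tether hits per bond of the pinned harmonic chain at temperature `T`
(level `b = 1`, `λ₀ = GT`, `λ₂ = 2T`): `ε(T) = 2 · (2π)⁻¹ √(λ₂/λ₀) e^{-1/(2λ₀)} =
e^{-1/(2GT)} √(2/G)/π`, written literally as in item `stmt-AtomisticToContinuum-6563`.
[cite: Aldous1989, §C23 eq. (C23b)] -/
def riceRateChain (ω₂ T : ℝ) : ℝ :=
  Real.exp (-(1 / (2 * stretchVarianceFactor ω₂ * T))) * Real.sqrt (2 / stretchVarianceFactor ω₂) /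
    Real.pi

/-- `0 < G(ω₂)` for `ω₂ ≥ 0` (indeed `G ≤ 1`). [folklore] -/
theorem stretchVarianceFactor_pos {ω₂ : ℝ} (hω : 0 ≤ ω₂) : 0 < stretchVarianceFactor ω₂ := by
  unfold stretchVarianceFactor
  have h4 : 0 < ω₂ + 4 := by linarith
  have hlt : ω₂ / (ω₂ + 4) < 1 := by rw [div_lt_one h4]; linarith
  have : Real.sqrt (ω₂ / (ω₂ + 4)) < 1 := by
    calc Real.sqrt (ω₂ / (ω₂ + 4)) < Real.sqrt 1 :=
          Real.sqrt_lt_sqrt (div_nonneg hω h4.le) hlt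
      _ = 1 := Real.sqrt_one
  linarith

/-- The Rice rate is positive (`ω₂ ≥ 0`, any `T`). [folklore] -/
theorem riceRateChain_pos {ω₂ : ℝ} (hω : 0 ≤ ω₂) (T : ℝ) : 0 < riceRateChain ω₂ T := by
  unfold riceRateChain
  have hG := stretchVarianceFactor_pos hω
  have : 0 < Real.sqrt (2 / stretchVarianceFactor ω₂) := Real.sqrt_pos.2 (by positivity)
  positivity

/-! ### The kernel, the collision rate and the operator -/

/-- The Palm-mismatch scattering kernel `ρ(k,k') = (2 - 2cos k)(2 - 2cos k')/(2π)` on `(-π,π]²`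
(per unit two-sided Rice rate): twice the product kernel `R(k)R(k')` of the nearest-neighbour
momentum-exchange noise. [cite: BasileBernardinJaraKomorowskiOlla2016, §6 (scattering rate
`R(k,k') = R(k)R(k')` of the simple exchange)] -/
def palmMismatchKernel (k k' : ℝ) : ℝ :=
  (2 - 2 * Real.cos k) * (2 - 2 * Real.cos k') / (2 * π)

/-- The total collision rate of mode `k`, `∫ ρ(k,k') dk' = 2(2 - 2cos k) = 8 sin²(k/2)` (see
`integral_palmMismatchKernel`); it vanishes quadratically at `k = 0`.
[cite: BasileBernardinJaraKomorowskiOlla2016, §6 (loss term `2γR(k)`, `R ∼ k²`)] -/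
def palmMismatchRate (k : ℝ) : ℝ :=
  2 * (2 - 2 * Real.cos k)

/-- **The Palm-mismatch collision operator** of the hard-tether pinned harmonic chain, acting on
energy-density Wigner profiles `W : ℝ → ℝ` (`2π`-periodic wavenumber), per unit two-sided Rice rate:
`(𝒦 W)(k) = ∫_{k' ∈ (-π,π]} ρ(k,k') (W k' - W k) dk'`, `ρ = palmMismatchKernel`. It is the
flow-averaged first-order Palm mismatch of the request (module docstring, (i)–(iv)), equal to the
linear Boltzmann collision operator `𝒞f = ∫ R(k,k')(f(k') - f(k))dk'` of the harmonic chain with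
nearest-neighbour exchange noise at intensity `2` per unit Rice rate. Bochner integral (`0` if
divergent).
[cite: BasileBernardinJaraKomorowskiOlla2016, §6 (collision term `𝒞f(k) = ∫ dk' R(k,k')[f(k') - f(k)]`)] -/
def palmMismatchOperator (W : ℝ → ℝ) (k : ℝ) : ℝ :=
  ∫ k' in Set.Ioc (-π) π, palmMismatchKernel k k' * (W k' - W k)

/-- The gain part of `𝒦`: `(2 - 2cos k)/(2π) · ∫_{(-π,π]} (2 - 2cos k') W(k') dk'` — rank one on each
fibre (multiplication by the profile `2 - 2cos k` of a single functional of `W`). [folklore] -/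
def palmMismatchGain (W : ℝ → ℝ) (k : ℝ) : ℝ :=
  (2 - 2 * Real.cos k) / (2 * π) * ∫ k' in Set.Ioc (-π) π, (2 - 2 * Real.cos k') * W k'

/-- **The Dirichlet form of `𝒦`**: `𝓔(W, W') = ½ ∫∫_{(-π,π]²} ρ(k,k') (W k - W k')(W' k - W' k')`;
formally `𝓔(W, W') = -∫ W' · 𝒦W dk` (symmetry of `ρ`), so `-𝒦 ≥ 0` on `L²((-π,π], dk)`; in the `G_T`
inner product of energy profiles (`T⁻² ×` flat at the Gibbs point) `⟨W, 𝒦W⟩_{G_T} = -T⁻² 𝓔(W, W)`.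
[folklore] -/
def palmMismatchForm (W W' : ℝ → ℝ) : ℝ :=
  (1 / 2 : ℝ) * ∫ k in Set.Ioc (-π) π, ∫ k' in Set.Ioc (-π) π,
    palmMismatchKernel k k' * ((W k - W k') * (W' k - W' k'))

/-- The same operator on NUMBER-density Wigner functions `w = W/ω` (phonon number per mode, equilibrium
`T/ω(k)`): `(𝒦_W w)(k) = ω(k)⁻¹ · 𝒦(ω · w)(k)`. [folklore] -/
def palmMismatchOperatorW (ω₂ : ℝ) (w : ℝ → ℝ) (k : ℝ) : ℝ :=
  (dispersion ω₂ k)⁻¹ * palmMismatchOperator (fun k' => dispersion ω₂ k' * w k') k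

/-- The kinetic medium of the Palm–Boltzmann slab problem (data for `KineticSlabConductance`):
modes `k ∈ (-π,π]` counted by `μ = (2π)⁻¹ dk` (one mode per site), normal velocity `v = ω'(k)`,
collision operator `𝒦`, specular reflection `k ↦ -k`, and the energy normalisation `e = w = 1`
(a wall at temperature `θ` emits `W ≡ θ`); `dom` = profiles integrable on `(-π,π]`.
[cite: KomorowskiOlla2020, §2.6.1 Definition 2.2] -/
def palmMismatchMedium (ω₂ : ℝ) : KineticMedium ℝ where
  μ := (ENNReal.ofReal (2 * π))⁻¹ • volume.restrict (Set.Ioc (-π) π)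
  v := groupVelocity ω₂
  C := palmMismatchOperator
  dom := {W | IntegrableOn W (Set.Ioc (-π) π)}
  refl := fun k => -k
  e := fun _ => 1
  w := fun _ => 1

/-! ### API -/

/-- `0 ≤ 2 - 2cos k`. [folklore] -/
theorem two_sub_two_mul_cos_nonneg (k : ℝ) : 0 ≤ 2 - 2 * Real.cos k := by
  linarith [Real.cos_le_one k]

/-- The kernel is non-negative. [folklore] -/
theorem palmMismatchKernel_nonneg (k k' : ℝ) : 0 ≤ palmMismatchKernel k k' := by
  unfold palmMismatchKernel
  have := two_sub_two_mul_cos_nonneg k; have := two_sub_two_mul_cos_nonneg k'; positivity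

/-- The kernel is symmetric (detailed balance at the flat Gibbs profile). [folklore] -/
theorem palmMismatchKernel_comm (k k' : ℝ) : palmMismatchKernel k k' = palmMismatchKernel k' k := by
  unfold palmMismatchKernel; ring

/-- The kernel is bounded: `ρ ≤ 8/π`. [folklore] -/
theorem palmMismatchKernel_le (k k' : ℝ) : palmMismatchKernel k k' ≤ 8 / π := by
  unfold palmMismatchKernel
  have h1 : 2 - 2 * Real.cos k ≤ 4 := by have := Real.neg_one_le_cos k; linarith
  have h2 : 2 - 2 * Real.cos k' ≤ 4 := by have := Real.neg_one_le_cos k'; linarith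
  have h1' := two_sub_two_mul_cos_nonneg k
  have h2' := two_sub_two_mul_cos_nonneg k'
  have h16 : (2 - 2 * Real.cos k) * (2 - 2 * Real.cos k') ≤ 16 := by
    nlinarith [mul_le_mul h1 h2 h2' (by norm_num : (0:ℝ) ≤ 4)]
  rw [show (8 : ℝ) / π = 16 / (2 * π) by field_simp; ring]
  gcongr

/-- The kernel factorises: `ρ(k,k') = (2-2cos k)/(2π) · (2-2cos k')`. [folklore] -/
theorem palmMismatchKernel_eq_mul (k k' : ℝ) :
    palmMismatchKernel k k' = (2 - 2 * Real.cos k) / (2 * π) * (2 - 2 * Real.cos k') := by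
  unfold palmMismatchKernel; ring

/-- The kernel is `2π`-periodic in each variable. [folklore] -/
theorem palmMismatchKernel_add_two_pi (k k' : ℝ) :
    palmMismatchKernel (k + 2 * π) k' = palmMismatchKernel k k' := by
  simp [palmMismatchKernel, Real.cos_add_two_pi]

/-- The kernel is even in each variable (reflection `k ↦ -k` symmetry). [folklore] -/
theorem palmMismatchKernel_neg (k k' : ℝ) :
    palmMismatchKernel (-k) k' = palmMismatchKernel k k' := by
  simp [palmMismatchKernel, Real.cos_neg]

/-- `∫_{(-π,π]} (2 - 2cos k') dk' = 4π`. [folklore] -/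
theorem integral_two_sub_two_mul_cos :
    ∫ k' in Set.Ioc (-π) π, (2 - 2 * Real.cos k') = 4 * π := by
  rw [← intervalIntegral.integral_of_le (by linarith [Real.pi_pos] : -π ≤ π)]
  rw [intervalIntegral.integral_sub intervalIntegrable_const
    (Real.continuous_cos.intervalIntegrable _ _ |>.const_mul 2)]
  rw [intervalIntegral.integral_const_mul, integral_cos, intervalIntegral.integral_const]
  simp [Real.sin_neg]
  ring

/-- **Total collision rate**: `∫_{(-π,π]} ρ(k,k') dk' = 2(2 - 2cos k)`. [folklore] -/
theorem integral_palmMismatchKernel (k : ℝ) :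
    ∫ k' in Set.Ioc (-π) π, palmMismatchKernel k k' = palmMismatchRate k := by
  simp_rw [palmMismatchKernel_eq_mul]
  rw [MeasureTheory.integral_const_mul, integral_two_sub_two_mul_cos]
  unfold palmMismatchRate
  have hπ : π ≠ 0 := Real.pi_ne_zero
  field_simp
  ring

/-- Unfolding `𝒦`. [folklore] -/
theorem palmMismatchOperator_apply (W : ℝ → ℝ) (k : ℝ) :
    palmMismatchOperator W k =
      ∫ k' in Set.Ioc (-π) π, palmMismatchKernel k k' * (W k' - W k) := rfl

/-- **Energy (and the Gibbs profile `W ≡ T`) is a collisional invariant**: `𝒦 c = 0`. [folklore] -/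
theorem palmMismatchOperator_const (c : ℝ) : palmMismatchOperator (fun _ => c) = 0 := by
  funext k
  simp [palmMismatchOperator]

/-- `𝒦` commutes with adding a constant profile: `𝒦(W + c) = 𝒦 W`. [folklore] -/
theorem palmMismatchOperator_add_const (W : ℝ → ℝ) (c : ℝ) :
    palmMismatchOperator (fun k => W k + c) = palmMismatchOperator W := by
  funext k
  simp only [palmMismatchOperator]
  congr 1; ext k'; ring

/-- An integrable profile times the bounded continuous factor `2 - 2cos` is integrable on `(-π,π]`.
[folklore] -/
theorem integrableOn_two_sub_cos_mul {W : ℝ → ℝ} (hW : IntegrableOn W (Set.Ioc (-π) π)) :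
    IntegrableOn (fun k' => (2 - 2 * Real.cos k') * W k') (Set.Ioc (-π) π) := by
  have hc : Continuous fun k' : ℝ => 2 - 2 * Real.cos k' := by fun_prop
  exact hW.continuousOn_mul_of_subset hc.continuousOn isCompact_Icc measurableSet_Ioc
    Set.Ioc_subset_Icc_self

/-- **Multiplication plus rank-one-per-fibre kernel**: for `W` integrable on `(-π,π]`,
`𝒦W(k) = (2-2cos k)/(2π) ∫(2-2cos k')W(k')dk' - 2(2-2cos k) W(k)`. [folklore] -/
theorem palmMismatchOperator_eq_gain_sub_rate_mul {W : ℝ → ℝ}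
    (hW : IntegrableOn W (Set.Ioc (-π) π)) (k : ℝ) :
    palmMismatchOperator W k = palmMismatchGain W k - palmMismatchRate k * W k := by
  unfold palmMismatchOperator palmMismatchGain
  have h1 : IntegrableOn (fun k' => palmMismatchKernel k k' * W k') (Set.Ioc (-π) π) := by
    simp_rw [palmMismatchKernel_eq_mul, mul_assoc]
    exact (integrableOn_two_sub_cos_mul hW).const_mul _
  have h2 : IntegrableOn (fun k' => palmMismatchKernel k k' * W k) (Set.Ioc (-π) π) := by
    have hc : Continuous fun k' => palmMismatchKernel k k' * W k := by
      unfold palmMismatchKernel; fun_prop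
    exact hc.integrableOn_Ioc
  simp_rw [mul_sub]
  rw [integral_sub h1 h2, MeasureTheory.integral_mul_const, integral_palmMismatchKernel]
  simp_rw [palmMismatchKernel_eq_mul, mul_assoc]
  rw [MeasureTheory.integral_const_mul]

/-- An odd profile has no gain: `∫_{(-π,π]} (2-2cos k') W(k') dk' = 0` when `W(-k) = -W(k)`.
[folklore] -/
theorem integral_two_sub_cos_mul_eq_zero_of_odd {W : ℝ → ℝ} (hodd : ∀ k, W (-k) = -W k) :
    ∫ k' in Set.Ioc (-π) π, (2 - 2 * Real.cos k') * W k' = 0 := by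
  rw [← intervalIntegral.integral_of_le (by linarith [Real.pi_pos] : -π ≤ π)]
  set g : ℝ → ℝ := fun k' => (2 - 2 * Real.cos k') * W k' with hg
  have hneg : ∀ x, g (-x) = -g x := by
    intro x; simp [hg, Real.cos_neg, hodd x]
  have h1 : ∫ x in (-π)..π, g (-x) = ∫ x in (-π)..π, g x := by
    rw [intervalIntegral.integral_comp_neg]; simp
  have h2 : ∫ x in (-π)..π, g (-x) = -∫ x in (-π)..π, g x := by
    simp_rw [hneg]; exact intervalIntegral.integral_neg
  linarith

/-- **The odd (current-carrying) sector**: for an odd profile integrable on `(-π,π]`,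
`𝒦W(k) = -2(2 - 2cos k) W(k) = -8 sin²(k/2) W(k)` — a non-positive multiplication operator whose rate
vanishes (quadratically) only at `k ∈ 2πℤ`. [folklore] -/
theorem palmMismatchOperator_odd {W : ℝ → ℝ} (hW : IntegrableOn W (Set.Ioc (-π) π))
    (hodd : ∀ k, W (-k) = -W k) (k : ℝ) :
    palmMismatchOperator W k = -(palmMismatchRate k * W k) := by
  rw [palmMismatchOperator_eq_gain_sub_rate_mul hW, palmMismatchGain,
    integral_two_sub_cos_mul_eq_zero_of_odd hodd]
  ring

/-- The odd-sector rate is non-negative … [folklore] -/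
theorem palmMismatchRate_nonneg (k : ℝ) : 0 ≤ palmMismatchRate k := by
  unfold palmMismatchRate; linarith [two_sub_two_mul_cos_nonneg k]

/-- … equals `8 sin²(k/2)` … [folklore] -/
theorem palmMismatchRate_eq_sin_sq (k : ℝ) : palmMismatchRate k = 8 * Real.sin (k / 2) ^ 2 := by
  unfold palmMismatchRate
  have h : Real.cos k = 1 - 2 * Real.sin (k / 2) ^ 2 := by
    have h1 : Real.cos k = 2 * Real.cos (k / 2) ^ 2 - 1 := by
      rw [← Real.cos_two_mul]; congr 1; ring
    have h2 := Real.sin_sq_add_cos_sq (k / 2)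
    linarith
  rw [h]; ring

/-- … and vanishes exactly on `2πℤ` (no uniform gap on the odd sector). [folklore] -/
theorem palmMismatchRate_eq_zero_iff (k : ℝ) :
    palmMismatchRate k = 0 ↔ ∃ m : ℤ, k = 2 * π * m := by
  rw [palmMismatchRate_eq_sin_sq]
  constructor
  · intro h
    have hs : Real.sin (k / 2) = 0 := by nlinarith [sq_nonneg (Real.sin (k / 2))]
    obtain ⟨m, hm⟩ := Real.sin_eq_zero_iff.1 hs
    exact ⟨m, by linarith⟩
  · rintro ⟨m, rfl⟩
    have : Real.sin (2 * π * m / 2) = 0 := by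
      rw [show 2 * π * (m : ℝ) / 2 = (m : ℝ) * π by ring]
      exact Real.sin_int_mul_pi m
    simp [this]

/-- `𝒦` maps `2π`-periodic profiles to `2π`-periodic profiles (it acts on functions on the torus).
[folklore] -/
theorem palmMismatchOperator_periodic {W : ℝ → ℝ} (hW : Function.Periodic W (2 * π)) :
    Function.Periodic (palmMismatchOperator W) (2 * π) := by
  intro k
  simp only [palmMismatchOperator, palmMismatchKernel_add_two_pi, hW k]

/-- The gain is even in `k` (the kernel is). [folklore] -/
theorem palmMismatchGain_neg (W : ℝ → ℝ) (k : ℝ) :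
    palmMismatchGain W (-k) = palmMismatchGain W k := by
  simp [palmMismatchGain, Real.cos_neg]

/-- The rate is even in `k`. [folklore] -/
theorem palmMismatchRate_neg (k : ℝ) : palmMismatchRate (-k) = palmMismatchRate k := by
  simp [palmMismatchRate, Real.cos_neg]

/-- **Reflection**: for `W` integrable on `(-π,π]`, `𝒦W(-k) - 𝒦W(k) = -2(2-2cos k)(W(-k) - W(k))`:
`𝒦` commutes with `k ↦ -k` and acts on the odd part `W(k) - W(-k)` by the rate alone. [folklore] -/
theorem palmMismatchOperator_neg {W : ℝ → ℝ} (hW : IntegrableOn W (Set.Ioc (-π) π)) (k : ℝ) :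
    palmMismatchOperator W (-k) =
      palmMismatchOperator W k - palmMismatchRate k * (W (-k) - W k) := by
  rw [palmMismatchOperator_eq_gain_sub_rate_mul hW, palmMismatchOperator_eq_gain_sub_rate_mul hW,
    palmMismatchGain_neg, palmMismatchRate_neg]
  ring

/-- The Dirichlet form is symmetric. [folklore] -/
theorem palmMismatchForm_comm (W W' : ℝ → ℝ) :
    palmMismatchForm W W' = palmMismatchForm W' W := by
  unfold palmMismatchForm
  congr 1; congr 1; ext k; congr 1; ext k'; ring

/-- **`-𝒦 ≥ 0` at the level of forms**: `𝓔(W, W) ≥ 0`. [folklore] -/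
theorem palmMismatchForm_self_nonneg (W : ℝ → ℝ) : 0 ≤ palmMismatchForm W W := by
  unfold palmMismatchForm
  apply mul_nonneg (by norm_num)
  apply MeasureTheory.integral_nonneg; intro k
  apply MeasureTheory.integral_nonneg; intro k'
  exact mul_nonneg (palmMismatchKernel_nonneg k k') (mul_self_nonneg _)

/-- Constant profiles are null for the Dirichlet form (energy conservation). [folklore] -/
theorem palmMismatchForm_const (c : ℝ) (W' : ℝ → ℝ) : palmMismatchForm (fun _ => c) W' = 0 := by
  simp [palmMismatchForm]

/-- Unfolding the number-normalised operator. [folklore] -/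
theorem palmMismatchOperatorW_apply (ω₂ : ℝ) (w : ℝ → ℝ) (k : ℝ) :
    palmMismatchOperatorW ω₂ w k =
      (dispersion ω₂ k)⁻¹ * palmMismatchOperator (fun k' => dispersion ω₂ k' * w k') k := rfl

/-- **The Rayleigh–Jeans profile `T/ω(k)` is stationary** for the number-normalised operator
(`ω₂ > 0`). [folklore] -/
theorem palmMismatchOperatorW_equilibrium {ω₂ : ℝ} (hω : 0 < ω₂) (T : ℝ) :
    palmMismatchOperatorW ω₂ (fun k => T / dispersion ω₂ k) = 0 := by
  funext k
  rw [palmMismatchOperatorW_apply]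
  have : (fun k' => dispersion ω₂ k' * (T / dispersion ω₂ k')) = fun _ => T := by
    funext k'
    rw [mul_div_cancel₀ _ (dispersion_pos hω k').ne']
  rw [this, palmMismatchOperator_const]
  simp

end Literature.MathematicalPhysics.KineticTheory.PhononBoltzmann
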